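import Literature.NumberTheory.Rogawski1990.UnitStableOrbitalIntegralHSideLevelValue       -- ★ p846028 (F3-1): `stableOrbitalIntegralRel_level_eq_sum_of_eigenframe`
import Literature.NumberTheory.Rogawski1990.UnitStableOrbitalIntegralHSideValueStubFrame   -- ★ (S1-bis): `stableOrbitalIntegralRel_indicator_eq_phiH_of_isRoot`, `eq_or_eq_eval_of_isRoot_of_eigenframe`
import Literature.NumberTheory.Automorphic.UnitaryEllipticCentralizerCompactNonsplit        -- ★ (E4) compact centralisers
import Literature.NumberTheory.Automorphic.RankTwoEigenframeOfSplitCharpoly                 -- ★ (E1) eigenframe from a root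
import Literature.NumberTheory.Rogawski1990.LocalHyperbolicClassIsLevi                      -- ★ (E3) norm-one eigenvalues from `hell`
import Literature.NumberTheory.Automorphic.LocalEndoscopicOrbitClosed                       -- ★ `isGRegular_of_isStablyConjH`
import Literature.NumberTheory.Rogawski1990.LocalCentralizerTorusMeasureCM                  -- ★ `isRegularElt_fst_snd_of_isLocalGRegular`
import Literature.NumberTheory.Automorphic.UnitOrbitalIntegralHSideGluingSum                -- ★ `cast_sum_gluingWeight_eq_div`
import Literature.NumberTheory.Automorphic.OrbitalMeasureQuotientOfPointHaarChange          -- ★ `quotientMeasure_nnreal_smul_haar`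
import Literature.NumberTheory.Rogawski1990.LocalTransferRescale                            -- ★ `classOrbitalIntegral_smul_measure_eq_mul`, `stableOrbitalIntegralRel_smul`
import Literature.NumberTheory.Automorphic.ValuedFieldValuativeRelBridge                    -- ★ `v_le_iff_valuation_le`, `v_lt_one_iff_valuation_lt_one`
import HarnessLib

/-!
# The H-side LEVEL values near the identity for ANY Haar measure, in the stub frame of the split eigen-data:
# `Φ^st(γ_H, 1_{K_H(i)}-class fn) = ν_H(K_H) · phiH q (N − i)` and `Φ^st(γ_H, 1_{K_H}) = ν_H(K_H) · phiH q N`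

Topic `NumberTheory/Rogawski1990`; namespaces `Literature.NumberTheory.Automorphic` (§1, generic) and `Literature.NumberTheory.Automorphic.UnitaryGroup` (§2–§3).
THEOREMS ONLY (no definition, no instance, no notation, no named fact, no `sorry`).  Cell `pub/hodgecm-mathlib`, crux H413, road «S3-tree», brick **T6 ∕ O8c «H-values
near 1»** in the currency of T3′ (holder F0P3b-p01 (g11), HEAD v4: arbitrary Haar `ν_H`, canonical `m_H`, split eigen-data `α ≠ γ`, `N = ord_w(α − γ)`; architect A-79:
«measures enter only through `ν_G(K) ∕ ν_H(K_H)`»); END∕T6 holder F0P3a-p03 (g15).  HC_CM is proved only modulo the cell's 2 remaining named inputs (hLiu418, h413) until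
rung 0 closes; this file is unconditional.

THE MATHEMATICS.  (§1) Orbital integrals are LINEAR in the quotient measure `dν∕dt`: if `m` is the canonical family for a Haar measure `ν` (★ `OrbitalMeasureFamily.IsCanonical`:
`m_c = dν∕dt_c`, `t_c` THE Haar measure on `Z(γ_c)` with mass one on the compact core), then `c • m` is canonical for `c • ν` (★ `quotientMeasure_nnreal_smul_haar`), so for a
compact open `K` the pair `(ν(K)⁻¹ν, ν(K)⁻¹m)` is a canonical pair normalised by `ν₁(K) = 1` and EVERY (stable) orbital integral against `m` is `ν(K)` times the normalised
one.  (§2–§3) Hence the ★ values proved under `ν_H(K_H) = 1` — the unit value `phiH q N` (★ `stableOrbitalIntegralRel_indicator_eq_phiH_of_isRoot`) and the level-`i`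
value `Σ_{j ≤ N − i} w(j) = phiH q (N − i)` (★ p846028 `stableOrbitalIntegralRel_level_eq_sum_of_eigenframe`, law «C1» of the S3 table: the fixed ball of radius `N − i` on the
`(q+1)`-regular tree [Flicker1998UnitaryFL, §6 p. 95]) — hold for an arbitrary Haar measure with the factor `ν_H(K_H)`, in the frame of the split eigen-data (`α, γ` the two
roots of `χ_{γ_H.1, w}`, `N = ord_w(α − γ)`, `γ ≡ 1 (mod ϖ_w^i)`; eigenframe ★ (E1), norm-one eigenvalues ★ (E3), compact centralisers ★ (E4), `G`-regularity of the
stable class ★ `isGRegular_of_isStablyConjH` — all discharged as in ★ (S1-bis)).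

* §1 `OrbitalMeasureFamily.IsCanonical.nnreal_smul`, `OrbitalMeasureFamily.IsCanonical.exists_normalised` (generic locally compact group).
* §2 `stableOrbitalIntegralRel_indicator_eq_mul_phiH_of_isRoot` — `Φ^st(γ_H, 1_{K_H}) = ν_H(K_H)·phiH q N`, any Haar `ν_H`.
* §3 `stableOrbitalIntegralRel_level_eq_mul_phiH_of_isRoot` — `Φ^st(γ_H, f) = ν_H(K_H)·phiH q (N − i)` for the level-`ϖ_w^i` class function `f` on `K_H`, `1 ≤ i ≤ N`,
  `|γ − 1|_w ≤ |ϖ_w^i|`, any Haar `ν_H`.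

## References
* [Rogawski1990] J. D. Rogawski, *Automorphic Representations of Unitary Groups in Three Variables* (1990), §1.7 p. 6; §4.3 (4.3.1) p. 43; §4.9 Prop. 4.9.1 (b) p. 55,
  Lemma 4.9.3 p. 56.
* [Flicker1998UnitaryFL] Y. Z. Flicker, *Elementary proof of the fundamental lemma for a unitary group*, Canad. J. Math. 50 (1998), §6 p. 95.
* [DeitmarEchterhoff2014] A. Deitmar, S. Echterhoff, *Principles of Harmonic Analysis*, 2nd ed. (2014), Thm. 1.5.3.
* [Kottwitz1988] R. E. Kottwitz, *Tamagawa numbers*, Ann. of Math. 127 (1988), §2.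
-/

set_option autoImplicit false

noncomputable section

open MeasureTheory Measure Set NumberField IsDedekindDomain Matrix Polynomial Finset ValuativeRel
open scoped ENNReal NNReal ValuativeRel Matrix MatrixGroups

/-! ## §1 Rescaling the Haar measure of a canonical pair -/

namespace Literature.NumberTheory.Automorphic

open Literature.NumberTheory.Rogawski1990

section Rescale

variable {G : Type*} [Group G] [TopologicalSpace G] [IsTopologicalGroup G] [LocallyCompactSpace G] [SecondCountableTopology G]
  [T2Space G] [MeasurableSpace G] [BorelSpace G]
  [∀ γ : G, MeasurableSpace (G ⧸ Subgroup.centralizer ({γ} : Set G))]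
  [∀ γ : G, BorelSpace (G ⧸ Subgroup.centralizer ({γ} : Set G))]

/-- **A canonical family rescales with the ambient Haar measure**: if `m` is canonical for `(P, ν)` then `c • m` is canonical for `(P, c • ν)` (`c > 0`):
the normalising torus measures `t` (mass one on the compact core) are untouched, and `d(cν)∕dt = c·dν∕dt` (★ `quotientMeasure_nnreal_smul_haar`).
[cite: Rogawski1990, §4.3 (4.3.1) p. 43; §1.7 p. 6] [cite: DeitmarEchterhoff2014, Thm. 1.5.3] -/
theorem OrbitalMeasureFamily.IsCanonical.nnreal_smul {P : G → Prop} {ν : Measure G} [ν.IsHaarMeasure] [ν.IsMulRightInvariant]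
    {m : OrbitalMeasureFamily G} (hm : m.IsCanonical P ν) {c : ℝ≥0} (hc : c ≠ 0) :
    haveI := IsHaarMeasure.nnreal_smul ν hc
    ((c : ℝ≥0∞) • m).IsCanonical P (c • ν) := by
  haveI := IsHaarMeasure.nnreal_smul ν hc
  intro cl hcl
  obtain ⟨t, ht, hti, h1, hmc⟩ := hm cl hcl
  refine ⟨t, ht, hti, h1, ?_⟩
  haveI : IsClosed ((Subgroup.centralizer ({(Quotient.out cl : G)} : Set G) : Subgroup G) : Set G) := isClosed_coe_centralizer_singleton _
  haveI : LocallyCompactSpace (Subgroup.centralizer ({(Quotient.out cl : G)} : Set G)) :=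
    (isClosed_coe_centralizer_singleton (Quotient.out cl)).isClosedEmbedding_subtypeVal.locallyCompactSpace
  haveI : SecondCountableTopology (Subgroup.centralizer ({(Quotient.out cl : G)} : Set G)) :=
    TopologicalSpace.Subtype.secondCountableTopology _
  rw [OrbitalMeasureFamily.smul_apply, hmc, quotientMeasure_nnreal_smul_haar _ t ν c hc]
  ext s _
  rw [Measure.smul_apply, Measure.smul_apply, ENNReal.smul_def]

/-- **NORMALISING THE HAAR MEASURE ON A COMPACT SET WITH NON-EMPTY INTERIOR** (e.g. a compact open subgroup): for ANY Haar measure `ν` and a canonical family `m`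
for `(P, ν)` there is a Haar measure `ν₁` with `ν₁(K) = 1` and a canonical family `m₁` for `(P, ν₁)` such that every class orbital integral and every stable orbital
integral against `m` is `ν(K)` times the one against `m₁` (`ν₁ = ν(K)⁻¹ν`, `m₁ = ν(K)⁻¹m`; ★ `classOrbitalIntegral_smul_measure_eq_mul`, ★ `stableOrbitalIntegralRel_smul`).
This is how the letter's arbitrary Haar measure enters the value formulas: through the factor `ν(K)` only.
[cite: Rogawski1990, §4.3 (4.3.1) p. 43; §1.7 p. 6] [cite: DeitmarEchterhoff2014, Thm. 1.5.3] -/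
theorem OrbitalMeasureFamily.IsCanonical.exists_normalised {P : G → Prop} {ν : Measure G} [ν.IsHaarMeasure] [ν.IsMulRightInvariant]
    {m : OrbitalMeasureFamily G} (hm : m.IsCanonical P ν) {K : Set G} (hK : IsCompact K) (hKi : (interior K).Nonempty) :
    ∃ (ν₁ : Measure G) (_ : ν₁.IsHaarMeasure) (_ : ν₁.IsMulRightInvariant) (m₁ : OrbitalMeasureFamily G),
      m₁.IsCanonical P ν₁ ∧ ν₁ K = 1 ∧
        (∀ (f : G → ℂ) (c : ConjClasses G), classOrbitalIntegral m f c = (ν.real K : ℂ) * classOrbitalIntegral m₁ f c) ∧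
        ∀ (st : G → G → Prop) (f : G → ℂ) (γ : G), stableOrbitalIntegralRel st m f γ = (ν.real K : ℂ) * stableOrbitalIntegralRel st m₁ f γ := by
  have h0 : ν K ≠ 0 := (Measure.measure_pos_of_nonempty_interior ν hKi).ne'
  have htop : ν K ≠ ⊤ := hK.measure_lt_top.ne
  set c : ℝ≥0 := ((ν K).toNNReal)⁻¹ with hc
  have hcK : (ν K).toNNReal ≠ 0 := by
    rw [Ne, ENNReal.toNNReal_eq_zero_iff, not_or]; exact ⟨h0, htop⟩
  have hc0 : c ≠ 0 := inv_ne_zero hcK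
  haveI := IsHaarMeasure.nnreal_smul ν hc0
  refine ⟨c • ν, inferInstance, inferInstance, (c : ℝ≥0∞) • m, hm.nnreal_smul hc0, ?_, ?_, ?_⟩
  · show c • ν K = 1
    rw [ENNReal.smul_def, smul_eq_mul, hc, ENNReal.coe_inv hcK, ENNReal.coe_toNNReal htop, ENNReal.inv_mul_cancel h0 htop]
  · intro f cl
    rw [classOrbitalIntegral_smul_measure_eq_mul, ← mul_assoc]
    have : (ν.real K : ℂ) * (((c : ℝ≥0∞)).toReal : ℂ) = 1 := by
      rw [Measure.real, hc, ENNReal.coe_inv hcK, ENNReal.coe_toNNReal htop, ENNReal.toReal_inv, ← Complex.ofReal_mul,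
        mul_inv_cancel₀ (ENNReal.toReal_ne_zero.2 ⟨h0, htop⟩), Complex.ofReal_one]
    rw [this, one_mul]
  · intro st f γ
    rw [stableOrbitalIntegralRel_smul, ← mul_assoc]
    have : (ν.real K : ℂ) * (((c : ℝ≥0∞)).toReal : ℂ) = 1 := by
      rw [Measure.real, hc, ENNReal.coe_inv hcK, ENNReal.coe_toNNReal htop, ENNReal.toReal_inv, ← Complex.ofReal_mul,
        mul_inv_cancel₀ (ENNReal.toReal_ne_zero.2 ⟨h0, htop⟩), Complex.ofReal_one]
    rw [this, one_mul]

end Rescale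

end Literature.NumberTheory.Automorphic

/-! ## §2–§3 The H-side values in the stub frame of the split eigen-data, any Haar measure -/

namespace Literature.NumberTheory.Automorphic.UnitaryGroup

open Literature.NumberTheory.Rogawski1990 Literature.NumberTheory.Automorphic

variable (L : Type) [Field L] [NumberField L] [IsCMField L] (v : HeightOneSpectrum (𝓞 ↥(maximalRealSubfield L)))
  (w : PlacesOver L v) (hw : IsCMField.complexConj L • w.1 = w.1)

omit [IsCMField L] in
/-- `2 ≤ q_v = |𝓞_{L⁺} ∕ v|` (a residue ring of a number ring at a nonzero prime). [cite: Rogawski1990, §4.9 p. 54] -/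
private theorem two_le_natCard_quotient : 2 ≤ Nat.card (𝓞 ↥(maximalRealSubfield L) ⧸ v.asIdeal) := by
  classical
  haveI : Finite (𝓞 ↥(maximalRealSubfield L) ⧸ v.asIdeal) := Ideal.finiteQuotientOfFreeOfNeBot v.asIdeal v.ne_bot
  haveI : Nontrivial (𝓞 ↥(maximalRealSubfield L) ⧸ v.asIdeal) := Ideal.Quotient.nontrivial_iff.2 v.isPrime.ne_top
  exact Finite.one_lt_card

/-- `K_H = U(Φ₂)(𝒪_v) × U(Φ₁)(𝒪_v)` is compact with non-empty interior (a compact open subgroup of `H_v`). [cite: Rogawski1990, §4.9 p. 54] -/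
theorem isCompact_and_interior_nonempty_prod_cmLocalIntegralLevel :
    IsCompact ((((cmLocalIntegralLevel L 2 (Matrix.of fun i j : Fin 2 => if i.val + j.val + 1 = 2 then (1 : L) else 0) v).prod (cmLocalIntegralLevel L 1 (Matrix.of fun i j : Fin 1 => if i.val + j.val + 1 = 1 then (1 : L) else 0) v)) : Subgroup ((cmDatum L 2 (Matrix.of fun i j : Fin 2 => if i.val + j.val + 1 = 2 then (1 : L) else 0)).Local v × (cmDatum L 1 (Matrix.of fun i j : Fin 1 => if i.val + j.val + 1 = 1 then (1 : L) else 0)).Local v)) : Set ((cmDatum L 2 (Matrix.of fun i j : Fin 2 => if i.val + j.val + 1 = 2 then (1 : L) else 0)).Local v × (cmDatum L 1 (Matrix.of fun i j : Fin 1 => if i.val + j.val + 1 = 1 then (1 : L) else 0)).Local v)) ∧ (interior ((((cmLocalIntegralLevel L 2 (Matrix.of fun i j : Fin 2 => if i.val + j.val + 1 = 2 then (1 : L) else 0) v).prod (cmLocalIntegralLevel L 1 (Matrix.of fun i j : Fin 1 => if i.val + j.val + 1 = 1 then (1 : L) else 0) v)) : Subgroup ((cmDatum L 2 (Matrix.of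 fun i j : Fin 2 => if i.val + j.val + 1 = 2 then (1 : L) else 0)).Local v × (cmDatum L 1 (Matrix.of fun i j : Fin 1 => if i.val + j.val + 1 = 1 then (1 : L) else 0)).Local v)) : Set ((cmDatum L 2 (Matrix.of fun i j : Fin 2 => if i.val + j.val + 1 = 2 then (1 : L) else 0)).Local v × (cmDatum L 1 (Matrix.of fun i j : Fin 1 => if i.val + j.val + 1 = 1 then (1 : L) else 0)).Local v))).Nonempty := by
  have h₂ := isCompact_isOpen_cmLocalIntegralLevel L 2 (Matrix.of fun i j : Fin 2 => if i.val + j.val + 1 = 2 then (1 : L) else 0) v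
  have h₁ := isCompact_isOpen_cmLocalIntegralLevel L 1 (Matrix.of fun i j : Fin 1 => if i.val + j.val + 1 = 1 then (1 : L) else 0) v
  have hKc : IsCompact ((((cmLocalIntegralLevel L 2 (Matrix.of fun i j : Fin 2 => if i.val + j.val + 1 = 2 then (1 : L) else 0) v).prod (cmLocalIntegralLevel L 1 (Matrix.of fun i j : Fin 1 => if i.val + j.val + 1 = 1 then (1 : L) else 0) v)) : Subgroup ((cmDatum L 2 (Matrix.of fun i j : Fin 2 => if i.val + j.val + 1 = 2 then (1 : L) else 0)).Local v × (cmDatum L 1 (Matrix.of fun i j : Fin 1 => if i.val + j.val + 1 = 1 then (1 : L) else 0)).Local v)) : Set ((cmDatum L 2 (Matrix.of fun i j : Fin 2 => if i.val + j.val + 1 = 2 then (1 : L) else 0)).Local v × (cmDatum L 1 (Matrix.of fun i j : Fin 1 => if i.val + j.val + 1 = 1 then (1 : L) else 0)).Local v)) := by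
    rw [Subgroup.coe_prod]; exact h₂.1.prod h₁.1
  have hKo : IsOpen ((((cmLocalIntegralLevel L 2 (Matrix.of fun i j : Fin 2 => if i.val + j.val + 1 = 2 then (1 : L) else 0) v).prod (cmLocalIntegralLevel L 1 (Matrix.of fun i j : Fin 1 => if i.val + j.val + 1 = 1 then (1 : L) else 0) v)) : Subgroup ((cmDatum L 2 (Matrix.of fun i j : Fin 2 => if i.val + j.val + 1 = 2 then (1 : L) else 0)).Local v × (cmDatum L 1 (Matrix.of fun i j : Fin 1 => if i.val + j.val + 1 = 1 then (1 : L) else 0)).Local v)) : Set ((cmDatum L 2 (Matrix.of fun i j : Fin 2 => if i.val + j.val + 1 = 2 then (1 : L) else 0)).Local v × (cmDatum L 1 (Matrix.of fun i j : Fin 1 => if i.val + j.val + 1 = 1 then (1 : L) else 0)).Local v)) := by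
    rw [Subgroup.coe_prod]; exact h₂.2.prod h₁.2
  exact ⟨hKc, by rw [hKo.interior_eq]; exact ⟨1, one_mem _⟩⟩

section Head

variable
  [MeasurableSpace ((cmDatum L 2 (Matrix.of fun i j : Fin 2 => if i.val + j.val + 1 = 2 then (1 : L) else 0)).Local v × (cmDatum L 1 (Matrix.of fun i j : Fin 1 => if i.val + j.val + 1 = 1 then (1 : L) else 0)).Local v)] [BorelSpace ((cmDatum L 2 (Matrix.of fun i j : Fin 2 => if i.val + j.val + 1 = 2 then (1 : L) else 0)).Local v × (cmDatum L 1 (Matrix.of fun i j : Fin 1 => if i.val + j.val + 1 = 1 then (1 : L) else 0)).Local v)]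
  [∀ a : (cmDatum L 2 (Matrix.of fun i j : Fin 2 => if i.val + j.val + 1 = 2 then (1 : L) else 0)).Local v × (cmDatum L 1 (Matrix.of fun i j : Fin 1 => if i.val + j.val + 1 = 1 then (1 : L) else 0)).Local v, MeasurableSpace (((cmDatum L 2 (Matrix.of fun i j : Fin 2 => if i.val + j.val + 1 = 2 then (1 : L) else 0)).Local v × (cmDatum L 1 (Matrix.of fun i j : Fin 1 => if i.val + j.val + 1 = 1 then (1 : L) else 0)).Local v) ⧸ Subgroup.centralizer ({a} : Set ((cmDatum L 2 (Matrix.of fun i j : Fin 2 => if i.val + j.val + 1 = 2 then (1 : L) else 0)).Local v × (cmDatum L 1 (Matrix.of fun i j : Fin 1 => if i.val + j.val + 1 = 1 then (1 : L) else 0)).Local v)))]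
  [∀ a : (cmDatum L 2 (Matrix.of fun i j : Fin 2 => if i.val + j.val + 1 = 2 then (1 : L) else 0)).Local v × (cmDatum L 1 (Matrix.of fun i j : Fin 1 => if i.val + j.val + 1 = 1 then (1 : L) else 0)).Local v, BorelSpace (((cmDatum L 2 (Matrix.of fun i j : Fin 2 => if i.val + j.val + 1 = 2 then (1 : L) else 0)).Local v × (cmDatum L 1 (Matrix.of fun i j : Fin 1 => if i.val + j.val + 1 = 1 then (1 : L) else 0)).Local v) ⧸ Subgroup.centralizer ({a} : Set ((cmDatum L 2 (Matrix.of fun i j : Fin 2 => if i.val + j.val + 1 = 2 then (1 : L) else 0)).Local v × (cmDatum L 1 (Matrix.of fun i j : Fin 1 => if i.val + j.val + 1 = 1 then (1 : L) else 0)).Local v)))]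
  (νH : Measure ((cmDatum L 2 (Matrix.of fun i j : Fin 2 => if i.val + j.val + 1 = 2 then (1 : L) else 0)).Local v × (cmDatum L 1 (Matrix.of fun i j : Fin 1 => if i.val + j.val + 1 = 1 then (1 : L) else 0)).Local v)) [νH.IsHaarMeasure] [νH.IsMulRightInvariant]

set_option maxHeartbeats 400000 in
include hw in
/-- **`Φ^st(γ_H, 1_{K_H}) = ν_H(K_H) · phiH q N` FOR ANY HAAR MEASURE `ν_H`** — ★ (S1-bis) `stableOrbitalIntegralRel_indicator_eq_phiH_of_isRoot` (stated under
`ν_H(K_H) = 1`) transported along §1: binders `w hw hv νH mH hmH γH hreg hell α γ hα hγ hαγ N hN` as there, minus the normalisation.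
[cite: Flicker1998UnitaryFL, §6 p. 95] [cite: Rogawski1990, §4.9 Prop. 4.9.1 (b) p. 55; §4.3 (4.3.1) p. 43] -/
theorem stableOrbitalIntegralRel_indicator_eq_mul_phiH_of_isRoot (hv : Algebra.IsUnramifiedIn (𝓞 L) v.asIdeal)
    {mH : OrbitalMeasureFamily ((cmDatum L 2 (Matrix.of fun i j : Fin 2 => if i.val + j.val + 1 = 2 then (1 : L) else 0)).Local v × (cmDatum L 1 (Matrix.of fun i j : Fin 1 => if i.val + j.val + 1 = 1 then (1 : L) else 0)).Local v)} (hmH : mH.IsCanonical (IsLocalGRegular L v) νH)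
    {γH : (cmDatum L 2 (Matrix.of fun i j : Fin 2 => if i.val + j.val + 1 = 2 then (1 : L) else 0)).Local v × (cmDatum L 1 (Matrix.of fun i j : Fin 1 => if i.val + j.val + 1 = 1 then (1 : L) else 0)).Local v} (hreg : IsLocalGRegular L v γH)
    (hell : ¬ ∃ (y : ((cmDatum L 2 (Matrix.of fun i j : Fin 2 => if i.val + j.val + 1 = 2 then (1 : L) else 0)).Local v × (cmDatum L 1 (Matrix.of fun i j : Fin 1 => if i.val + j.val + 1 = 1 then (1 : L) else 0)).Local v)) (d' : Fin 2 → (UnitaryGroup.LocalRing L v)ˣ),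
        glDiagonal 2 (UnitaryGroup.LocalRing L v) d' = ((y * γH * y⁻¹).1.val : GL (Fin 2) (UnitaryGroup.LocalRing L v)))
    (α γ : (w.1.adicCompletion L))
    (hα : ((((γH.1.val : GL (Fin 2) (LocalRing L v)) : Matrix (Fin 2) (Fin 2) (LocalRing L v)).charpoly).map (Pi.evalRingHom (fun w' : PlacesOver L v => w'.1.adicCompletion L) w)).IsRoot α)
    (hγ : ((((γH.1.val : GL (Fin 2) (LocalRing L v)) : Matrix (Fin 2) (Fin 2) (LocalRing L v)).charpoly).map (Pi.evalRingHom (fun w' : PlacesOver L v => w'.1.adicCompletion L) w)).IsRoot γ)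
    (hαγ : α ≠ γ) (N : ℕ) (hN : Valued.v (α - γ) = WithZero.exp (-(N : ℤ))) :
    stableOrbitalIntegralRel (IsLocalStablyConjH L v) mH (((((cmLocalIntegralLevel L 2 (Matrix.of fun i j : Fin 2 => if i.val + j.val + 1 = 2 then (1 : L) else 0) v).prod (cmLocalIntegralLevel L 1 (Matrix.of fun i j : Fin 1 => if i.val + j.val + 1 = 1 then (1 : L) else 0) v)) : Subgroup ((cmDatum L 2 (Matrix.of fun i j : Fin 2 => if i.val + j.val + 1 = 2 then (1 : L) else 0)).Local v × (cmDatum L 1 (Matrix.of fun i j : Fin 1 => if i.val + j.val + 1 = 1 then (1 : L) else 0)).Local v)) : Set ((cmDatum L 2 (Matrix.of fun i j : Fin 2 => if i.val + j.val + 1 = 2 then (1 : L) else 0)).Local v × (cmDatum L 1 (Matrix.of fun i j : Fin 1 => if i.val + j.val + 1 = 1 then (1 : L) else 0)).Local v)).indicator fun _ => (1 : ℂ)) γH =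
      (νH.real ((((cmLocalIntegralLevel L 2 (Matrix.of fun i j : Fin 2 => if i.val + j.val + 1 = 2 then (1 : L) else 0) v).prod (cmLocalIntegralLevel L 1 (Matrix.of fun i j : Fin 1 => if i.val + j.val + 1 = 1 then (1 : L) else 0) v)) : Subgroup ((cmDatum L 2 (Matrix.of fun i j : Fin 2 => if i.val + j.val + 1 = 2 then (1 : L) else 0)).Local v × (cmDatum L 1 (Matrix.of fun i j : Fin 1 => if i.val + j.val + 1 = 1 then (1 : L) else 0)).Local v)) : Set ((cmDatum L 2 (Matrix.of fun i j : Fin 2 => if i.val + j.val + 1 = 2 then (1 : L) else 0)).Local v × (cmDatum L 1 (Matrix.of fun i j : Fin 1 => if i.val + j.val + 1 = 1 then (1 : L) else 0)).Local v)) : ℂ) * ((Flicker1998.phiH (Ideal.absNorm v.asIdeal) N : ℚ) : ℂ) := by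
  obtain ⟨hKc, hKi⟩ := isCompact_and_interior_nonempty_prod_cmLocalIntegralLevel L v
  obtain ⟨ν₁, hν₁, hν₁', m₁, hm₁, h1, -, hst⟩ := hmH.exists_normalised hKc hKi
  rw [hst, stableOrbitalIntegralRel_indicator_eq_phiH_of_isRoot L v w hw ν₁ hv hm₁ h1 hreg hell α γ hα hγ hαγ N hN]

set_option maxHeartbeats 400000 in
include hw in
/-- **THE LEVEL-`i` H-SIDE VALUE IN THE STUB FRAME, ANY HAAR MEASURE: `Φ^st(γ_H, f) = ν_H(K_H) · phiH q (N − i)`** for `γ_H = (g, u)` `G`-regular and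
elliptic (`hell`: not `H_v`-conjugate to a diagonal element), `α ≠ γ` the two roots of `χ_{g,w}` in `L_w`, `N = ord_w(α − γ)`, `1 ≤ i ≤ N`, `|γ − 1|_w ≤ |ϖ_w^i|`
(`γ_H` deep), and `f` the level-`ϖ_w^i` class function on `K_H` (continuous, supported in `K_H`, `K_H`-conjugation invariant, `= [(h₂)_w ≡ 1 (mod ϖ_w^i)]` on `K_H`).
★ p846028 `stableOrbitalIntegralRel_level_eq_sum_of_eigenframe` with its frame data discharged as in ★ (S1-bis) (eigenframe ★ (E1) through the root `α`, second
eigenvalue `= γ`, norm-one eigenvalues ★ (E3) from `hell`, compact centralisers ★ (E4), `G`-regularity of the stable class), transported to any Haar measure by §1, and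
`Σ_{j ≤ N−i} w(j) = phiH q (N − i)` (★ `cast_sum_gluingWeight_eq_div`).  Law «C1» of the S3 table in T3′'s currency.
[cite: Flicker1998UnitaryFL, §6 p. 95] [cite: Rogawski1990, §4.9 Prop. 4.9.1 (b) p. 55, Lemma 4.9.3 p. 56; §4.3 (4.3.1) p. 43] [cite: Kottwitz1988, §2] -/
theorem stableOrbitalIntegralRel_level_eq_mul_phiH_of_isRoot (hv : Algebra.IsUnramifiedIn (𝓞 L) v.asIdeal)
    {mH : OrbitalMeasureFamily ((cmDatum L 2 (Matrix.of fun i j : Fin 2 => if i.val + j.val + 1 = 2 then (1 : L) else 0)).Local v × (cmDatum L 1 (Matrix.of fun i j : Fin 1 => if i.val + j.val + 1 = 1 then (1 : L) else 0)).Local v)} (hmH : mH.IsCanonical (IsLocalGRegular L v) νH)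
    {γH : (cmDatum L 2 (Matrix.of fun i j : Fin 2 => if i.val + j.val + 1 = 2 then (1 : L) else 0)).Local v × (cmDatum L 1 (Matrix.of fun i j : Fin 1 => if i.val + j.val + 1 = 1 then (1 : L) else 0)).Local v} (hreg : IsLocalGRegular L v γH)
    (hell : ¬ ∃ (y : ((cmDatum L 2 (Matrix.of fun i j : Fin 2 => if i.val + j.val + 1 = 2 then (1 : L) else 0)).Local v × (cmDatum L 1 (Matrix.of fun i j : Fin 1 => if i.val + j.val + 1 = 1 then (1 : L) else 0)).Local v)) (d' : Fin 2 → (UnitaryGroup.LocalRing L v)ˣ),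
        glDiagonal 2 (UnitaryGroup.LocalRing L v) d' = ((y * γH * y⁻¹).1.val : GL (Fin 2) (UnitaryGroup.LocalRing L v)))
    (α γ : (w.1.adicCompletion L))
    (hα : ((((γH.1.val : GL (Fin 2) (LocalRing L v)) : Matrix (Fin 2) (Fin 2) (LocalRing L v)).charpoly).map (Pi.evalRingHom (fun w' : PlacesOver L v => w'.1.adicCompletion L) w)).IsRoot α)
    (hγ : ((((γH.1.val : GL (Fin 2) (LocalRing L v)) : Matrix (Fin 2) (Fin 2) (LocalRing L v)).charpoly).map (Pi.evalRingHom (fun w' : PlacesOver L v => w'.1.adicCompletion L) w)).IsRoot γ)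
    (hαγ : α ≠ γ) (N : ℕ) (hN : Valued.v (α - γ) = WithZero.exp (-(N : ℤ)))
    {i : ℕ} (hi : 1 ≤ i) (hiN : i ≤ N) (hγi : Valued.v (γ - 1) ≤ WithZero.exp (-(i : ℤ)))
    (f : ((cmDatum L 2 (Matrix.of fun i j : Fin 2 => if i.val + j.val + 1 = 2 then (1 : L) else 0)).Local v × (cmDatum L 1 (Matrix.of fun i j : Fin 1 => if i.val + j.val + 1 = 1 then (1 : L) else 0)).Local v) → ℂ) (hfc : Continuous f) (hfK : Function.support f ⊆ ((((cmLocalIntegralLevel L 2 (Matrix.of fun i j : Fin 2 => if i.val + j.val + 1 = 2 then (1 : L) else 0) v).prod (cmLocalIntegralLevel L 1 (Matrix.of fun i j : Fin 1 => if i.val + j.val + 1 = 1 then (1 : L) else 0) v)) : Subgroup ((cmDatum L 2 (Matrix.of fun i j : Fin 2 => if i.val + j.val + 1 = 2 then (1 : L) else 0)).Local v × (cmDatum L 1 (Matrix.of fun i j : Fin 1 => if i.val + j.val + 1 = 1 then (1 : L) else 0)).Local v)) : Set ((cmDatum L 2 (Matrix.of fun i j : Fin 2 => if i.val + j.val + 1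 = 2 then (1 : L) else 0)).Local v × (cmDatum L 1 (Matrix.of fun i j : Fin 1 => if i.val + j.val + 1 = 1 then (1 : L) else 0)).Local v)))
    (hfinv : ∀ k ∈ (((cmLocalIntegralLevel L 2 (Matrix.of fun i j : Fin 2 => if i.val + j.val + 1 = 2 then (1 : L) else 0) v).prod (cmLocalIntegralLevel L 1 (Matrix.of fun i j : Fin 1 => if i.val + j.val + 1 = 1 then (1 : L) else 0) v)) : Subgroup ((cmDatum L 2 (Matrix.of fun i j : Fin 2 => if i.val + j.val + 1 = 2 then (1 : L) else 0)).Local v × (cmDatum L 1 (Matrix.of fun i j : Fin 1 => if i.val + j.val + 1 = 1 then (1 : L) else 0)).Local v)), ∀ x, f (k * x * k⁻¹) = f x)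
    (hf1 : ∀ x ∈ (((cmLocalIntegralLevel L 2 (Matrix.of fun i j : Fin 2 => if i.val + j.val + 1 = 2 then (1 : L) else 0) v).prod (cmLocalIntegralLevel L 1 (Matrix.of fun i j : Fin 1 => if i.val + j.val + 1 = 1 then (1 : L) else 0) v)) : Subgroup ((cmDatum L 2 (Matrix.of fun i j : Fin 2 => if i.val + j.val + 1 = 2 then (1 : L) else 0)).Local v × (cmDatum L 1 (Matrix.of fun i j : Fin 1 => if i.val + j.val + 1 = 1 then (1 : L) else 0)).Local v)), (∀ a b, valuation (w.1.adicCompletion L) ((((((localNonsplitEquiv (IsCMField.complexConj L) (Matrix.of fun i j : Fin 2 => if i.val + j.val + 1 = 2 then (1 : L) else 0) (IsCMField.complexConj_ne_one L) w hw) x.1 : ↥(unitaryGroupOfForm (galAdicCompletionMap (L := L) (IsCMField.complexConj L) hw) (placeForm (Matrix.of fun i j : Fin 2 => if i.val + j.val + 1 = 2 then (1 : L) else 0) w.1))) : GL (Fin 2) (w.1.adicCompletion L)) : Matrix (Fin 2) (Fin 2) (w.1.adicCompletion L)) - 1) a b) ≤ valuation (w.1.adicCompletion L) ((toPlace v w (GaloisRepresentations.HeckeCharacter.uniformizer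 ↥(maximalRealSubfield L) v : v.adicCompletion ↥(maximalRealSubfield L))) ^ i)) → f x = 1)
    (hf0 : ∀ x ∈ (((cmLocalIntegralLevel L 2 (Matrix.of fun i j : Fin 2 => if i.val + j.val + 1 = 2 then (1 : L) else 0) v).prod (cmLocalIntegralLevel L 1 (Matrix.of fun i j : Fin 1 => if i.val + j.val + 1 = 1 then (1 : L) else 0) v)) : Subgroup ((cmDatum L 2 (Matrix.of fun i j : Fin 2 => if i.val + j.val + 1 = 2 then (1 : L) else 0)).Local v × (cmDatum L 1 (Matrix.of fun i j : Fin 1 => if i.val + j.val + 1 = 1 then (1 : L) else 0)).Local v)), ¬ (∀ a b, valuation (w.1.adicCompletion L) ((((((localNonsplitEquiv (IsCMField.complexConj L) (Matrix.of fun i j : Fin 2 => if i.val + j.val + 1 = 2 then (1 : L) else 0) (IsCMField.complexConj_ne_one L) w hw) x.1 : ↥(unitaryGroupOfForm (galAdicCompletionMap (L := L) (IsCMField.complexConj L) hw) (placeForm (Matrix.of fun i j : Fin 2 => if i.val + j.val + 1 = 2 then (1 : L) else 0) w.1))) : GL (Fin 2) (w.1.adicCompletion L)) : Matrix (Fin 2)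 (Fin 2) (w.1.adicCompletion L)) - 1) a b) ≤ valuation (w.1.adicCompletion L) ((toPlace v w (GaloisRepresentations.HeckeCharacter.uniformizer ↥(maximalRealSubfield L) v : v.adicCompletion ↥(maximalRealSubfield L))) ^ i)) → f x = 0) :
    stableOrbitalIntegralRel (IsLocalStablyConjH L v) mH f γH =
      (νH.real ((((cmLocalIntegralLevel L 2 (Matrix.of fun i j : Fin 2 => if i.val + j.val + 1 = 2 then (1 : L) else 0) v).prod (cmLocalIntegralLevel L 1 (Matrix.of fun i j : Fin 1 => if i.val + j.val + 1 = 1 then (1 : L) else 0) v)) : Subgroup ((cmDatum L 2 (Matrix.of fun i j : Fin 2 => if i.val + j.val + 1 = 2 then (1 : L) else 0)).Local v × (cmDatum L 1 (Matrix.of fun i j : Fin 1 => if i.val + j.val + 1 = 1 then (1 : L) else 0)).Local v)) : Set ((cmDatum L 2 (Matrix.of fun i j : Fin 2 => if i.val + j.val + 1 = 2 then (1 : L) else 0)).Local v × (cmDatum L 1 (Matrix.of fun i j : Fin 1 => if i.val + j.val + 1 = 1 then (1 : L) else 0)).Local v)) : ℂ) * ((Flicker1998.phiH (Ideal.absNorm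 v.asIdeal) (N - i) : ℚ) : ℂ) := by
  have hc1 : IsCMField.complexConj L ≠ 1 := IsCMField.complexConj_ne_one L
  -- §1: normalise the Haar measure on `K_H`
  obtain ⟨hKc, hKi⟩ := isCompact_and_interior_nonempty_prod_cmLocalIntegralLevel L v
  obtain ⟨ν₁, hν₁, hν₁', m₁, hm₁, h1, -, hst⟩ := hmH.exists_normalised hKc hKi
  rw [hst]
  congr 1
  -- (E1) the eigenframe over `E_v`, `u₀(w) = α`
  have hsep : (((γH.1.val : GL (Fin 2) (LocalRing L v)) : Matrix (Fin 2) (Fin 2) (LocalRing L v)).charpoly).Separable :=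
    (isRegularElt_fst_snd_of_isLocalGRegular L v γH hreg).1
  obtain ⟨P, u, hP, hu, hu0⟩ := exists_eigenframe_cmDatum_local_of_isRoot_map_of_separable L v w hw γH.1 hα hsep
  -- the second eigenvalue at `w` is `γ`
  have hu1w : u 1 w = γ := by
    rcases eq_or_eq_eval_of_isRoot_of_eigenframe L v w hP hγ with h | h
    · exact absurd (h.trans hu0) (Ne.symm hαγ)
    · exact h.symm
  -- (E3) norm-one eigenvalues from ellipticity
  have hu1 : ∀ i, conjLocal L (IsCMField.complexConj L) v (u i) * u i = 1 :=
    forall_conjLocal_mul_eq_one_of_not_exists_conj_glDiagonal L v w hw hP hu hell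
  -- (E4) compact centralisers, both classes
  haveI : CompactSpace (Subgroup.centralizer ({γH.1} : Set ((cmDatum L 2 (Matrix.of fun i j : Fin 2 => if i.val + j.val + 1 = 2 then (1 : L) else 0)).Local v))) :=
    compactSpace_centralizer_of_eigenframe_of_smul_eq L w hw (Matrix.of fun i j : Fin 2 => if i.val + j.val + 1 = 2 then (1 : L) else 0) (antidiagOne_isHermitian L 2) (by
      rw [Matrix.det_fin_two]; simp [Matrix.of_apply]) γH.1 hP hu hu1
  have hcpt : ∀ δ : (cmDatum L 2 (Matrix.of fun i j : Fin 2 => if i.val + j.val + 1 = 2 then (1 : L) else 0)).Local v, IsStablyConj (conjLocal L (IsCMField.complexConj L) v) ((adelicForm L 2 (Matrix.of fun i j : Fin 2 => if i.val + j.val + 1 = 2 then (1 : L) else 0)).map (adeleToLocal L v)) γH.1 δ →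
      CompactSpace (Subgroup.centralizer ({δ} : Set ((cmDatum L 2 (Matrix.of fun i j : Fin 2 => if i.val + j.val + 1 = 2 then (1 : L) else 0)).Local v))) := fun δ hst => by
    obtain ⟨x, hx⟩ := isConj_iff.1 hst
    have hx' : δ.val = x * γH.1.val * x⁻¹ := hx.symm
    have hQ : δ.val.val * (x * P).val = (x * P).val * diagonal u := by
      rw [hx', Units.val_mul, Units.val_mul, Units.val_mul, Matrix.mul_assoc (x.val * γH.1.val.val), ← Matrix.mul_assoc (x⁻¹).val,
        Units.inv_mul, Matrix.one_mul, Matrix.mul_assoc, hP, ← Matrix.mul_assoc]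
    exact compactSpace_centralizer_of_eigenframe_of_smul_eq L w hw (Matrix.of fun i j : Fin 2 => if i.val + j.val + 1 = 2 then (1 : L) else 0) (antidiagOne_isHermitian L 2) (by
      rw [Matrix.det_fin_two]; simp [Matrix.of_apply]) δ hQ hu hu1
  -- `G`-regularity of the second class
  have hreg' : ∀ δ : (cmDatum L 2 (Matrix.of fun i j : Fin 2 => if i.val + j.val + 1 = 2 then (1 : L) else 0)).Local v, IsStablyConj (conjLocal L (IsCMField.complexConj L) v) ((adelicForm L 2 (Matrix.of fun i j : Fin 2 => if i.val + j.val + 1 = 2 then (1 : L) else 0)).map (adeleToLocal L v)) γH.1 δ →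
      IsLocalGRegular L v (δ, γH.2) := fun δ hst =>
    isGRegular_of_isStablyConjH (conjLocal L (IsCMField.complexConj L) v)
      ((adelicForm L 2 (Matrix.of fun i j : Fin 2 => if i.val + j.val + 1 = 2 then (1 : L) else 0)).map (adeleToLocal L v)) ((adelicForm L 1 (Matrix.of fun i j : Fin 1 => if i.val + j.val + 1 = 1 then (1 : L) else 0)).map (adeleToLocal L v))
      ((adelicForm L 3 (Matrix.of fun i j : Fin 3 => if i.val + j.val + 1 = 3 then (1 : L) else 0)).map (adeleToLocal L v)) (h := endoForm_localForm L v) (a := γH) (a' := (δ, γH.2))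
      ⟨hst, IsStablyConj.refl _⟩ hreg
  -- `N` and the deepness in the `valuation` currency: `u₀(w) − u₁(w) = α − γ`, `u₁(w) − 1 = γ − 1`, `v_w(ϖ^n) = exp(−n)`
  have hϖ1 := Liu2021.LemD1IndexedNonVacuityInertCofinite.valued_toPlace_uniformizer_of_isUnramifiedIn L v hv w
  have hϖn : ∀ n : ℕ, Valued.v ((toPlace v w (GaloisRepresentations.HeckeCharacter.uniformizer ↥(maximalRealSubfield L) v : v.adicCompletion ↥(maximalRealSubfield L))) ^ n) = WithZero.exp (-(n : ℤ)) := fun n => by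
    rw [map_pow, hϖ1, ← WithZero.exp_nsmul]; simp
  have hN' : valuation (w.1.adicCompletion L) (u 0 w - u 1 w) = valuation (w.1.adicCompletion L) ((toPlace v w (GaloisRepresentations.HeckeCharacter.uniformizer ↥(maximalRealSubfield L) v : v.adicCompletion ↥(maximalRealSubfield L))) ^ N) := by
    rw [hu0, hu1w]
    exact (v_eq_iff_valuation_eq _ _).1 (by rw [hN, hϖn])
  have hui : valuation (w.1.adicCompletion L) (u 1 w - 1) ≤ valuation (w.1.adicCompletion L) ((toPlace v w (GaloisRepresentations.HeckeCharacter.uniformizer ↥(maximalRealSubfield L) v : v.adicCompletion ↥(maximalRealSubfield L))) ^ i) := by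
    rw [hu1w]
    exact (v_le_iff_valuation_le _ _).1 (by rw [hϖn]; exact hγi)
  -- ★ p846028 at the normalised pair, then `Σ_{j ≤ N−i} w(j) = phiH q (N − i)`
  have key := stableOrbitalIntegralRel_level_eq_sum_of_eigenframe L v w hw ν₁ hv hm₁ h1 γH.1 γH.2 hreg hP hu hu1 hN' hi hui f hfc hfK hfinv hf1 hf0 hiN hcpt hreg'
  refine key.trans ?_
  rw [HSideGluingSum.cast_sum_gluingWeight_eq_div (two_le_natCard_quotient L v) (N - i), Flicker1998.phiH, Ideal.absNorm_apply, Submodule.cardQuot_apply]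
  push_cast
  ring

end Head

end Literature.NumberTheory.Automorphic.UnitaryGroup

end
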